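import Summits.SmoothPoincare4.SmoothPoincare4.Theorems.EntropyRungChangGurskyYangStubSmoothRoundLimitAux7
import Summits.SmoothPoincare4.SmoothPoincare4.Theorems.EntropyRungChangGurskyYangStubSmoothRoundLimitAux8
import Summits.SmoothPoincare4.SmoothPoincare4.Theorems.EntropyRungChangGurskyYangStubSmoothRoundLimitAux9
import HarnessLib

/-!
# Decay of the covariant Ricci derivatives of the scaled flow, by interpolation (Hamilton 1982, §17)
(helper file 10 for stub `stub_smoothRoundLimit`, line `margerin-cone-hamilton-rails`, crux
`EntropyRung.ChangGurskyYang`, item stmt-SmoothPoincare4-10834)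

Pure coordinate calculus on a closed chart ball `B̄(y₀, R) ⊆ V` along a smooth family of metric
components `G_t`, `t ∈ [t₀, T)` (`h = T − t`). INPUT (all on `B̄(y₀, R) × [t₀, T)`): logarithmic
growth of `Γ` and squared-logarithmic growth of `∂Γ` (helper files 6–7), bounded components of
all `∇ᵏRic` (scaled Shi bounds), and the decay `|Ric_J − (2h)⁻¹ G_J| ≤ D₀ h^{δ₀}` of the round
defect (roundness rates). OUTPUT: **for every `k` there are `θ_k > 0`, `C_k` with
`|(∇ᵏ⁺¹Ric)_J| ≤ C_k h^{θ_k}` on `B̄(y₀, R/2) × [t₀, T)`** (`tcovIter_ric2_decay`), i.e. the covariant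
Ricci derivatives of the scaled metrics `G/h` (whose components are these, by scale invariance)
DECAY — Hamilton 1982, §17 ("the derivatives `∇ᵏRic` of the normalised flow decay
exponentially"), here with a polynomial rate, which is what makes `∂ₜΓ = −g⁻¹ ⋆ ∇Ric` integrable
in `t` (§14, Lemma 14.2 ff.).

Proof: induction on `k` on shrinking balls `B̄(y₀, R/2 + R/2^{k+2})`, each step being Landau's
interpolation (helper file 8) of the scalar functions `(∇ᵏRic)_J` (resp. the defect `φ_J` for
`k = 0`) between their decaying sup bound and the bound `O((1 + log(h₀/h))²) = O(h^{−θ/4})` of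
their second coordinate derivatives (helper file 9), followed by
`(∇ᵏ⁺¹Ric) = ∂(∇ᵏRic) − Γ ⋆ ∇ᵏRic`.

## References

* R. S. Hamilton, *Three-manifolds with positive Ricci curvature*, J. Differential Geom. 17
  (1982) 255–306, §12, §14 (Lemma 14.2 ff.), §17 (Thm. 17.6, Cor. 17.10). [Hamilton1982]
* E. Landau, Proc. LMS 13 (1913), 43–49.
-/

noncomputable section

-- every `Summit.SmoothPoincare4.SmoothPoincare4.…` name repeats the summit = sub-problem segment (D-0017 layout)
set_option linter.dupNamespace false

-- operator spaces of bilinear forms over the model space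
set_option maxSynthPendingDepth 3

open Set Function Filter Real Module Metric
open scoped Topology ContDiff

namespace Summit.SmoothPoincare4.SmoothPoincare4.Theorems.MargerinRails

open Literature.Geometry.Lorentzian Literature.Geometry.Lorentzian.MetricCoord
open Literature.Geometry.Riemannian (coordSum coordSum_nonneg)

universe u

/-! ### Real bookkeeping -/

section RealLemmas

/-- Monomials of degree `≤ 2` in `X ≥ 1` are dominated by `X²` (nonnegative coefficients): the
shape of the second-derivative bounds of helper file 9 with `L = A₀ X`, `L' = A₁ X²`. [folklore] -/
theorem quad_shape_le {X A₀ A₁ c₀ c₁ c₂ a a' : ℝ} (hX : 1 ≤ X) (hA₀ : 0 ≤ A₀)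
    (hc₁ : 0 ≤ c₁) (hc₂ : 0 ≤ c₂) (ha : 0 ≤ a) (ha' : 0 ≤ a') :
    (c₂ + a * (A₀ * X * c₁)) + a' * (A₁ * X ^ 2 * c₀ + A₀ * X * (c₁ + a' * (A₀ * X * c₀))) ≤
      ((c₂ + a * (A₀ * c₁)) + a' * (A₁ * c₀ + A₀ * (c₁ + a' * (A₀ * c₀)))) * X ^ 2 := by
  have hX0 : 0 ≤ X := zero_le_one.trans hX
  have hX1 : X ≤ X ^ 2 := by nlinarith
  have hX2 : 1 ≤ X ^ 2 := by nlinarith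
  have t1 : c₂ ≤ c₂ * X ^ 2 := by nlinarith
  have t2 : a * (A₀ * X * c₁) ≤ a * (A₀ * c₁) * X ^ 2 := by
    have : 0 ≤ a * A₀ * c₁ := by positivity
    nlinarith
  have t3 : a' * (A₀ * X * c₁) ≤ a' * (A₀ * c₁) * X ^ 2 := by
    have : 0 ≤ a' * A₀ * c₁ := by positivity
    nlinarith
  have t4 : a' * (A₀ * X * (a' * (A₀ * X * c₀))) = a' * (A₀ * (a' * (A₀ * c₀))) * X ^ 2 := by ring
  have t5 : a' * (A₁ * X ^ 2 * c₀) = a' * (A₁ * c₀) * X ^ 2 := by ring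
  nlinarith

/-- `h^a ≤ (T−t₀)^{a−c} h^c` for `0 < h ≤ T − t₀` and `c ≤ a` (monotonicity of `rpow` in the
exponent... in the base). [folklore] -/
theorem rpow_le_mul_rpow {h h₀ a c : ℝ} (hh : 0 < h) (hh₀ : h ≤ h₀) (hca : c ≤ a) :
    h ^ a ≤ h₀ ^ (a - c) * h ^ c := by
  have h1 : h ^ a = h ^ (a - c) * h ^ c := by rw [← rpow_add hh]; ring_nf
  rw [h1]
  exact mul_le_mul_of_nonneg_right (rpow_le_rpow hh.le hh₀ (sub_nonneg.2 hca)) (rpow_nonneg hh.le c)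

end RealLemmas

/-! ### The interpolation engine on a chart ball -/

section Engine

variable {E : Type u} [NormedAddCommGroup E] [NormedSpace ℝ E] [FiniteDimensional ℝ E]
  {ι : Type*} [Fintype ι] (b : Basis ι ℝ E)

/-- **Landau's interpolation with the rates**: for `φ` smooth on an open `U ⊇ ball y r'`, if
`|φ| ≤ D h^θ` and `|∂_p ∂_q φ| ≤ B h^{−θ/4}` on the ball (`0 < h ≤ h₀`), then
`‖Dφ(y)‖ ≤ K h^{θ/4}` with `K` explicit (`norm_fderiv_le_of_pd_pd_le` + `le_mul_rpow_of_interp`).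
[cite: Hamilton1982, §12] -/
theorem norm_fderiv_le_rpow_of_bounds {U : Set E} (hU : IsOpen U) {φ : E → ℝ} (hφ : ContDiffOn ℝ ∞ φ U)
    {y : E} {r' : ℝ} (hr' : 0 < r') (hball : ball y r' ⊆ U) {θ h h₀ D B : ℝ} (hθ : 0 < θ)
    (hh : 0 < h) (hh₀ : h ≤ h₀) (hD : 0 ≤ D) (hB : 0 ≤ B)
    (h0 : ∀ y' ∈ ball y r', |φ y'| ≤ D * h ^ θ)
    (h2 : ∀ y' ∈ ball y r', ∀ p q : ι, |pd b p (pd b q φ) y'| ≤ B * h ^ (-(θ / 4))) :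
    ‖fderiv ℝ φ y‖ ≤ (2 * D * h₀ ^ (θ / 4) + coordSum b ^ 2 * Fintype.card ι ^ 2 * B +
        (4 * D * h₀ ^ θ / r' + r' / 2 * (coordSum b ^ 2 * Fintype.card ι ^ 2 * B) * (r' / 2) ^ (-(1 / 2 : ℝ))) *
          (r' / 2) ^ (-(1 / 2 : ℝ))) * h ^ (θ / 4) := by
  refine le_mul_rpow_of_interp hθ hr' hh hh₀ hD (by positivity) fun s hs hsr ↦ ?_
  have := norm_fderiv_le_of_pd_pd_le b hU hφ hball (mul_nonneg hB (rpow_nonneg hh.le _)) h0 h2 hs hsr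
  refine this.trans (le_of_eq ?_)
  ring

end Engine

/-! ### The induction along the family -/

section Decay

variable {E : Type u} [NormedAddCommGroup E] [NormedSpace ℝ E] [FiniteDimensional ℝ E]
  [CompleteSpace E] {ι : Type*} [Fintype ι] (b : Basis ι ℝ E)
  {G : ℝ → E → E →L[ℝ] E →L[ℝ] ℝ} {V : Set E} {t₀ T : ℝ} {y₀ : E} {R : ℝ}
  (hG : IsMetricFamilyOn G (Ico t₀ T) V) (ht₀ : t₀ < T) (hKV : closedBall y₀ R ⊆ V)
  {A₀ : ℝ} (hA₀ : 0 ≤ A₀) (hΓ : ∀ t ∈ Ico t₀ T, ∀ y ∈ closedBall y₀ R, ∀ j i m : ι,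
    |chrCoef (G t) b y j i m| ≤ A₀ * (1 + Real.log ((T - t₀) / (T - t))))
  {A₁ : ℝ} (hA₁ : 0 ≤ A₁) (hdΓ : ∀ t ∈ Ico t₀ T, ∀ y ∈ closedBall y₀ R, ∀ p j i m : ι,
    |pd b p (fun y' ↦ chrCoef (G t) b y' j i m) y| ≤ A₁ * (1 + Real.log ((T - t₀) / (T - t))) ^ 2)
  (hRk : ∀ k : ℕ, ∃ Ck : ℝ, ∀ t ∈ Ico t₀ T, ∀ y ∈ closedBall y₀ R, ∀ J : Fin k ⊕ Fin 2 → ι,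
    |tcovIter (G t) b k (ric2 (G t) b) y J| ≤ Ck)

include hG ht₀ hKV hA₀ hΓ hA₁ hdΓ hRk

omit [NormedSpace ℝ E] [FiniteDimensional ℝ E] [CompleteSpace E] [Fintype ι] hG ht₀ hKV hA₀ hΓ hA₁ hdΓ hRk in
/-- A ball around a point of `B̄(y₀, ρ')` of radius `ρ − ρ'` stays in `B̄(y₀, ρ)`. [folklore] -/
theorem ball_subset_closedBall_of_mem {y : E} {ρ ρ' : ℝ} (hy : y ∈ closedBall y₀ ρ') :
    ball y (ρ - ρ') ⊆ closedBall y₀ ρ := by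
  intro z hz
  rw [mem_closedBall] at hy ⊢
  rw [mem_ball] at hz
  linarith [dist_triangle z y y₀]

/-- **The induction step**: decay of `∇ᵏ⁺¹Ric` at rate `θ` on `B̄(y₀, ρ)` gives decay of `∇ᵏ⁺²Ric`
at rate `θ/4` on `B̄(y₀, ρ')`, `ρ' < ρ ≤ R`. [cite: Hamilton1982, §17, Thm. 17.6, Cor. 17.10] -/
theorem tcovIter_ric2_decay_step (k : ℕ) {ρ ρ' θ C : ℝ} (hρρ' : ρ' < ρ) (hρR : ρ ≤ R)
    (hθ : 0 < θ)
    (hk : ∀ t ∈ Ico t₀ T, ∀ y ∈ closedBall y₀ ρ, ∀ J : Fin (k + 1) ⊕ Fin 2 → ι,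
      |tcovIter (G t) b (k + 1) (ric2 (G t) b) y J| ≤ C * (T - t) ^ θ) :
    ∃ C' : ℝ, ∀ t ∈ Ico t₀ T, ∀ y ∈ closedBall y₀ ρ', ∀ J : Fin (k + 2) ⊕ Fin 2 → ι,
      |tcovIter (G t) b (k + 2) (ric2 (G t) b) y J| ≤ C' * (T - t) ^ (θ / 4) := by
  have hV : IsOpen V := hG.isOpen ⟨le_rfl, ht₀⟩
  have hρ : closedBall y₀ ρ ⊆ closedBall y₀ R := closedBall_subset_closedBall hρR
  have hT₀ : 0 < T - t₀ := sub_pos.2 ht₀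
  -- the constants
  obtain ⟨C₁, hC₁⟩ := hRk (k + 1)
  obtain ⟨C₂, hC₂⟩ := hRk (k + 2)
  obtain ⟨C₃, hC₃⟩ := hRk (k + 3)
  set n : ℝ := (Fintype.card ι : ℝ) with hn
  set a₁ : ℝ := Fintype.card (Fin (k + 1) ⊕ Fin 2) * n with ha₁
  set a₂ : ℝ := Fintype.card (Fin (k + 2) ⊕ Fin 2) * n with ha₂
  set Bq : ℝ := (|C₃| + a₂ * (A₀ * |C₂|)) + a₁ * (A₁ * |C₁| + A₀ * (|C₂| + a₁ * (A₀ * |C₁|))) with hBq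
  have hBq0 : 0 ≤ Bq := by positivity
  -- `(1 + ℓ)² ≤ Kℓ h^{-θ/4}` with `2ε = θ/4`
  set Kℓ : ℝ := (1 + 1 / (θ / 8)) ^ 2 * (T - t₀) ^ (2 * (θ / 8)) with hKℓ
  have hKℓ0 : 0 ≤ Kℓ := by positivity
  have hlog : ∀ t ∈ Ico t₀ T, (1 + Real.log ((T - t₀) / (T - t))) ^ 2 ≤ Kℓ * (T - t) ^ (-(θ / 4)) := by
    intro t ht
    have := one_add_log_ratio_sq_le ht (by positivity : 0 < θ / 8)
    rw [show 2 * (θ / 8) = θ / 4 by ring] at this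
    rw [hKℓ, show 2 * (θ / 8) = θ / 4 by ring]
    exact this
  set D : ℝ := max C 0 with hD
  set B : ℝ := Bq * Kℓ with hB
  have hB0 : 0 ≤ B := by positivity
  set r' : ℝ := ρ - ρ' with hr'
  have hr'0 : 0 < r' := by rw [hr']; linarith
  -- the engine constant and the final constant
  set K : ℝ := 2 * D * (T - t₀) ^ (θ / 4) + coordSum b ^ 2 * Fintype.card ι ^ 2 * B +
    (4 * D * (T - t₀) ^ θ / r' + r' / 2 * (coordSum b ^ 2 * Fintype.card ι ^ 2 * B) * (r' / 2) ^ (-(1 / 2 : ℝ))) *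
      (r' / 2) ^ (-(1 / 2 : ℝ)) with hK
  set Bb : ℝ := ∑ q, ‖b q‖ with hBb
  refine ⟨Bb * K + a₁ * (A₀ * D) * Kℓ * (T - t₀) ^ (θ / 2), fun t ht y hy J' ↦ ?_⟩
  have hTt : 0 < T - t := sub_pos.2 ht.2
  have hhle : T - t ≤ T - t₀ := by linarith [ht.1]
  obtain ⟨-, hℓ0⟩ := log_ratio_eq ht
  have hX : 1 ≤ 1 + Real.log ((T - t₀) / (T - t)) := by linarith
  have hyR : y ∈ closedBall y₀ R := hρ (closedBall_subset_closedBall hρρ'.le hy)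
  have hyV : y ∈ V := hKV hyR
  have hGt : IsMetricOn (G t) V := hG.isMetricOn t ht
  -- Step 1: `R_{k+2}` through `∂ R_{k+1}`
  have hLt := hΓ t ht y hyR
  have hstep := abs_tcovIter_succ_le_pd b (Gs := G t) (k + 1) hLt (fun J ↦ hk t ht y (closedBall_subset_closedBall hρρ'.le hy) J) J'
  set q : ι := J' (shiftEquiv (k + 1) (Fin 2) none) with hq
  set J : Fin (k + 1) ⊕ Fin 2 → ι := (J' ∘ ⇑(shiftEquiv (k + 1) (Fin 2))) ∘ some with hJ
  set φ : E → ℝ := fun z ↦ tcovIter (G t) b (k + 1) (ric2 (G t) b) z J with hφ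
  -- Step 2: the engine for `φ`
  have hφs : ContDiffOn ℝ ∞ φ V := (hGt.tsmoothOn_tcovIter (hGt.tsmoothOn_ric2 (b := b)) (k + 1)) J
  have hballV : ball y r' ⊆ V := (ball_subset_closedBall_of_mem hy).trans (hρ.trans hKV)
  have h0 : ∀ y' ∈ ball y r', |φ y'| ≤ D * (T - t) ^ θ := fun y' hy' ↦
    (hk t ht y' (ball_subset_closedBall_of_mem hy hy') J).trans
      (mul_le_mul_of_nonneg_right (le_max_left _ _) (rpow_nonneg hTt.le _))
  have h2 : ∀ y' ∈ ball y r', ∀ p q' : ι, |pd b p (pd b q' φ) y'| ≤ B * (T - t) ^ (-(θ / 4)) := by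
    intro y' hy' p q'
    have hy'R : y' ∈ closedBall y₀ R := hρ (ball_subset_closedBall_of_mem hy hy')
    have hy'V : y' ∈ V := hKV hy'R
    have key := abs_pd_pd_tcovIter_le b hGt (k + 1) hy'V (hΓ t ht y' hy'R) (hdΓ t ht y' hy'R)
      (fun J ↦ (hC₁ t ht y' hy'R J).trans (le_abs_self _)) (fun J ↦ (hC₂ t ht y' hy'R J).trans (le_abs_self _))
      (fun J ↦ (hC₃ t ht y' hy'R J).trans (le_abs_self _)) p q' J
    have hshape := quad_shape_le (A₁ := A₁) (c₀ := |C₁|) (c₁ := |C₂|) (c₂ := |C₃|) (a := a₂) (a' := a₁) hX hA₀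
      (abs_nonneg _) (abs_nonneg _) (by positivity) (by positivity)
    calc _ ≤ _ := key
      _ ≤ Bq * (1 + Real.log ((T - t₀) / (T - t))) ^ 2 := hshape
      _ ≤ Bq * (Kℓ * (T - t) ^ (-(θ / 4))) := mul_le_mul_of_nonneg_left (hlog t ht) hBq0
      _ = B * (T - t) ^ (-(θ / 4)) := by rw [hB]; ring
  have hengine := norm_fderiv_le_rpow_of_bounds b hV hφs hr'0 hballV hθ hTt hhle (le_max_right _ _) hB0 h0 h2
  rw [← hK] at hengine
  -- Step 3: assemble
  have hpd : |pd b q φ y| ≤ Bb * K * (T - t) ^ (θ / 4) := by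
    refine (abs_pd_le_norm_fderiv b φ y q).trans ?_
    have hbq : ‖b q‖ ≤ Bb := Finset.single_le_sum (f := fun q ↦ ‖b q‖) (fun _ _ ↦ norm_nonneg _) (Finset.mem_univ q)
    have hK0 : 0 ≤ K * (T - t) ^ (θ / 4) := le_trans (norm_nonneg _) hengine
    calc ‖fderiv ℝ φ y‖ * ‖b q‖ ≤ (K * (T - t) ^ (θ / 4)) * Bb := mul_le_mul hengine hbq (norm_nonneg _) hK0
      _ = Bb * K * (T - t) ^ (θ / 4) := by ring
  have htail : (Fintype.card (Fin (k + 1) ⊕ Fin 2) : ℝ) * Fintype.card ι *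
      (A₀ * (1 + Real.log ((T - t₀) / (T - t))) * (C * (T - t) ^ θ)) ≤
      a₁ * (A₀ * D) * Kℓ * (T - t₀) ^ (θ / 2) * (T - t) ^ (θ / 4) := by
    have hCh : 0 ≤ C * (T - t) ^ θ := (abs_nonneg _).trans (hk t ht y (closedBall_subset_closedBall hρρ'.le hy) J)
    have h1 : C * (T - t) ^ θ ≤ D * (T - t) ^ θ := mul_le_mul_of_nonneg_right (le_max_left _ _) (rpow_nonneg hTt.le _)
    have hX2 : (1 + Real.log ((T - t₀) / (T - t))) ≤ (1 + Real.log ((T - t₀) / (T - t))) ^ 2 :=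
      le_self_pow₀ hX two_ne_zero
    have h2 : (1 + Real.log ((T - t₀) / (T - t))) ≤ Kℓ * (T - t) ^ (-(θ / 4)) := hX2.trans (hlog t ht)
    have h3 : (T - t) ^ (-(θ / 4)) * (T - t) ^ θ ≤ (T - t₀) ^ (θ / 2) * (T - t) ^ (θ / 4) := by
      rw [← rpow_add hTt]
      have := rpow_le_mul_rpow (a := -(θ / 4) + θ) (c := θ / 4) hTt hhle (by linarith)
      rw [show -(θ / 4) + θ - θ / 4 = θ / 2 by ring] at this
      exact this
    have hD0 : 0 ≤ D := le_max_right _ _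
    have h4 : A₀ * (1 + Real.log ((T - t₀) / (T - t))) * (C * (T - t) ^ θ) ≤
        A₀ * (Kℓ * (T - t) ^ (-(θ / 4))) * (D * (T - t) ^ θ) :=
      mul_le_mul (mul_le_mul_of_nonneg_left h2 hA₀) h1 hCh (by positivity)
    have ha₁0 : 0 ≤ a₁ := by positivity
    calc (Fintype.card (Fin (k + 1) ⊕ Fin 2) : ℝ) * Fintype.card ι *
          (A₀ * (1 + Real.log ((T - t₀) / (T - t))) * (C * (T - t) ^ θ))
        = a₁ * (A₀ * (1 + Real.log ((T - t₀) / (T - t))) * (C * (T - t) ^ θ)) := by rw [ha₁, hn]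
      _ ≤ a₁ * (A₀ * (Kℓ * (T - t) ^ (-(θ / 4))) * (D * (T - t) ^ θ)) := mul_le_mul_of_nonneg_left h4 ha₁0
      _ = a₁ * (A₀ * D) * Kℓ * ((T - t) ^ (-(θ / 4)) * (T - t) ^ θ) := by ring
      _ ≤ a₁ * (A₀ * D) * Kℓ * ((T - t₀) ^ (θ / 2) * (T - t) ^ (θ / 4)) :=
          mul_le_mul_of_nonneg_left h3 (by positivity)
      _ = _ := by ring
  calc |tcovIter (G t) b (k + 2) (ric2 (G t) b) y J'| ≤ _ := hstep
    _ ≤ Bb * K * (T - t) ^ (θ / 4) + a₁ * (A₀ * D) * Kℓ * (T - t₀) ^ (θ / 2) * (T - t) ^ (θ / 4) :=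
        add_le_add hpd htail
    _ = _ := by ring

omit [CompleteSpace E] hG ht₀ hKV hA₀ hΓ hA₁ hdΓ hRk in
/-- **HELPER `helper_tcovIter_ric2_decay_step`** — the registered form of
`tcovIter_ric2_decay_step` (one step of the interpolation induction: decay of `∇ᵏ⁺¹Ric` at rate
`θ` on a ball gives decay of `∇ᵏ⁺²Ric` at rate `θ/4` on a smaller ball).
[cite: Hamilton1982, §17, Thm. 17.6, Cor. 17.10] -/
theorem helper_tcovIter_ric2_decay_step : ∀ {E : Type u} [NormedAddCommGroup E] [NormedSpace ℝ E] [FiniteDimensional ℝ E] [CompleteSpace E] {ι : Type*} [Fintype ι] (b : Module.Basis ι ℝ E) {G : ℝ → E → E →L[ℝ] E →L[ℝ] ℝ} {V : Set E} {t₀ T : ℝ} {y₀ : E} {R : ℝ}, MetricCoord.IsMetricFamilyOn G (Ico t₀ T) V → t₀ < T → Metric.closedBall y₀ R ⊆ V → ∀ {A₀ : ℝ}, 0 ≤ A₀ → (∀ t ∈ Ico t₀ T, ∀ y ∈ Metric.closedBall y₀ R, ∀ j i m : ι, |MetricCoord.chrCoef (G t) b y j i m| ≤ A₀ * (1 + Real.log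 ((T - t₀) / (T - t)))) → ∀ {A₁ : ℝ}, 0 ≤ A₁ → (∀ t ∈ Ico t₀ T, ∀ y ∈ Metric.closedBall y₀ R, ∀ p j i m : ι, |MetricCoord.pd b p (fun y' ↦ MetricCoord.chrCoef (G t) b y' j i m) y| ≤ A₁ * (1 + Real.log ((T - t₀) / (T - t))) ^ 2) → (∀ k : ℕ, ∃ Ck : ℝ, ∀ t ∈ Ico t₀ T, ∀ y ∈ Metric.closedBall y₀ R, ∀ J : Fin k ⊕ Fin 2 → ι, |MetricCoord.tcovIter (G t) b k (MetricCoord.ric2 (G t) b) y J| ≤ Ck) → ∀ (k : ℕ) {ρ ρ' θ C : ℝ}, ρ' < ρ → ρ ≤ R → 0 < θ → (∀ t ∈ Ico t₀ T, ∀ y ∈ Metric.closedBall y₀ ρ, ∀ J : Fin (k + 1) ⊕ Fin 2 → ι, |MetricCoord.tcovIter (G t) b (k + 1) (MetricCoord.ric2 (G t) b) y J| ≤ C * (T - t) ^ θ) → ∃ C' : ℝ, ∀ t ∈ Ico t₀ T, ∀ y ∈ Metric.closedBall y₀ ρ', ∀ J : Fin (k + 2) ⊕ Fin 2 → ι, |MetricCoord.tcovIter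 (G t) b (k + 2) (MetricCoord.ric2 (G t) b) y J| ≤ C' * (T - t) ^ (θ / 4) := by
  intro E _ _ _ _ ι _ b G V t₀ T y₀ R hG ht₀ hKV A₀ hA₀ hΓ A₁ hA₁ hdΓ hRk k ρ ρ' θ C hρρ' hρR hθ hk
  exact tcovIter_ric2_decay_step b hG ht₀ hKV hA₀ hΓ hA₁ hdΓ hRk k hρρ' hρR hθ hk

end Decay

end Summit.SmoothPoincare4.SmoothPoincare4.Theorems.MargerinRails

end
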